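import Mathlib
import Literature.MathematicalPhysics.QuantumFieldTheory.PottsGaugeWilsonLoopTopology
import HarnessLib

/-!
# Homological percolation of the plaquette random-cluster model on `𝕋⁴_N`: the sharp giant-cycle
# transition at the self-dual point (Duncan–Schweinhart, CMP 406 (2025), Theorem 8) — named fact

Fourth file of the transcription of the Fortuin–Kasteleyn-type representation of `q`-state Potts
lattice gauge theory (companions: `PlaquetteRandomCluster` — setting, readings (R1)–(R3), SCOPE
caveat: `ℤ_q`/Potts gauge theory only, nothing here bears on the Yang–Mills mass gap or on
`BalabanLadder.IR`; in the `ym` ladder only the conditional finite-`𝕋⁴` rung `BalabanLadder.UV` is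
closed by any route —, `PottsGaugeEdwardsSokal`, `PottsGaugeWilsonLoopTopology`).

Source: P. Duncan, B. Schweinhart, *Topological phases in the plaquette random-cluster model and
Potts lattice gauge theory*, Comm. Math. Phys. **406** (2025), arXiv:2207.08339 (loci of the arXiv
version) [DuncanSchweinhart2025]: §3 (giant and local cycles: `φ_* : H_i(P; F) → H_i(𝕋^d; F)`,
`b_i = rank φ_*`), §4.3 (the dual parameter `p* = (1-p)q/((1-p)q + p)`, the self-dual point
`p_sd = √q/(1+√q)`), §1.1 **Theorem 8** (= Theorem (thm:half) of §6): for `d = 2i` and a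
coefficient field `F` with `char F ≠ 2`, with `A` = "`φ_*` is non-trivial" and `S` = "`φ_*` is
surjective", `μ_{𝕋^d_N}(A) → 0` for `p < p_sd(q)` and `μ_{𝕋^d_N}(S) → 1` for `p > p_sd(q)` as
`N → ∞`; §6.1 (interpretation: for `i = 2` giant sheets ruled by Polyakov loops, Prop. 36 /
Cor. 37). This is the one printed SHARP result for the four-dimensional (`i = 2`, `d = 4`) gauge
case; the area-law/perimeter-law sharpness for Wilson loops themselves (Conjectures 4, 6) is open.

## Readings (transcriber's)

* (R8) `3`-cells of `𝕋^d_L` are `(x; i < j < k)`; the boundary `bd₃ w ∈ C₂` of a `3`-chain is the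
  transpose of the tree's `td₂ ∘ ext` (the flux through the faces of the cube, `AbelianTorusCochains`)
  in the cell bases, as for `bd₂` (reading R4 of `PottsGaugeEdwardsSokal`).
* (R9) The event `A` ("`φ_*` non-trivial") is: some `2`-cycle supported on the open plaquettes is
  not a `2`-boundary of the full torus complex (`HasGiantCycle`); `S` ("`φ_*` surjective") is:
  every `2`-cycle of the torus is homologous in the torus to a `2`-cycle supported on the open
  plaquettes (`GiantCyclesSpan`). Coefficients in the field `F` of the model.
* (R10) "`N → ∞`" is the limit along all side lengths `L = N + 1 ≥ 1` (`Filter.atTop` on `ℕ`);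
  the parameters are restricted to `p ∈ [0,1]`, `q ≥ 1` (the standing assumptions of §4; the fact is
  therefore not stronger than the print).

## Contents

* `Cell₃`, `bd₃`, `IsTwoCycle`, `IsTwoBoundary`, `HasGiantCycle` (event `A`), `GiantCyclesSpan`
  (event `S`); `dualParam` (`p*`), `selfDualPoint` (`p_sd`) with `dualParam_selfDualPoint` (PROVED:
  `p_sd` is the fixed point of `p ↦ p*`);
* `DuncanSchweinhart_sharpGiantCycleTransition` — **Theorem 8 for `i = 2`, `d = 4`, NAMED FACT**
  (the proof uses duality on the torus, Theorem 18, the Graham–Grimmett sharp-threshold theorem and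
  the irreducible-representation lemma of Duncan–Kahle–Schweinhart; none of this is in the tree).
-/

open Finset Filter

namespace Literature.MathematicalPhysics.QuantumFieldTheory

namespace PlaquetteRC

open LatticeForm
open scoped _root_.Topology

variable {d L : ℕ}

/-! ### `3`-cells, `∂₃`, `2`-cycles and giant cycles -/

section Cells

variable [NeZero L] {R : Type*} [CommRing R]

/-- The positively oriented `3`-cells `(x; i < j < k)` of the torus `𝕋^d_L`. [cite: DuncanSchweinhart2025, §2.1 (i-plaquettes of 𝕋^d_N)] -/
abbrev Cell₃ (d L : ℕ) : Type :=
  Site d L × {t : Fin d × Fin d × Fin d // t.1 < t.2.1 ∧ t.2.1 < t.2.2}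

/-- The boundary `∂w ∈ C₂` of a `3`-chain `w`, the transpose of the coboundary `td₂ ∘ ext` in the
cell bases: `(∂w)(σ) = Σ_c w(c) (δ𝟙_σ)(c)` (reading R8). [cite: DuncanSchweinhart2025, §2.1 (∂ of an i-plaquette) and §1.1 Def. 2 (δf(σ) = f(∂σ))] -/
def bd₃ [DecidableEq (Plaquette d L)] (w : Cell₃ d L → R) : Plaquette d L → R :=
  fun σ => ∑ c : Cell₃ d L, w c * td₂ (ext (plaqInd (R := R) σ)) c.1 c.2.1.1 c.2.1.2.1 c.2.1.2.2

/-- A `2`-cycle of the torus: `∂z = 0`. [cite: DuncanSchweinhart2025, §2.1 (Z_i)] -/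
def IsTwoCycle (z : Plaquette d L → R) : Prop := bd₂ z = 0

/-- A `2`-boundary of the FULL torus complex: `z = ∂w` for some `3`-chain `w` of `𝕋^d_L`.
[cite: DuncanSchweinhart2025, §2.1 (B_i)] -/
def IsTwoBoundary [DecidableEq (Plaquette d L)] (z : Plaquette d L → R) : Prop :=
  ∃ w : Cell₃ d L → R, bd₃ w = z

/-- **Event `A` (a giant cycle / "giant sheet")**: the map `φ_* : H₂(P(ω); R) → H₂(𝕋^d_L; R)`
induced by the inclusion is non-trivial, i.e. some `2`-cycle supported on the open plaquettes is
not a boundary in the torus (reading R9). [cite: DuncanSchweinhart2025, Thm. 8 (event A) and §3 (giant cycles)] -/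
def HasGiantCycle [DecidableEq (Plaquette d L)] (ω : Finset (Plaquette d L)) : Prop :=
  ∃ z : Plaquette d L → R, (∀ σ, σ ∉ ω → z σ = 0) ∧ IsTwoCycle z ∧ ¬ IsTwoBoundary z

/-- **Event `S`**: `φ_* : H₂(P(ω); R) → H₂(𝕋^d_L; R)` is surjective, i.e. every `2`-cycle of the
torus is homologous (in the torus) to a `2`-cycle supported on the open plaquettes (reading R9).
[cite: DuncanSchweinhart2025, Thm. 8 (event S)] -/
def GiantCyclesSpan [DecidableEq (Plaquette d L)] (ω : Finset (Plaquette d L)) : Prop :=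
  ∀ z' : Plaquette d L → R, IsTwoCycle z' →
    ∃ z : Plaquette d L → R, (∀ σ, σ ∉ ω → z σ = 0) ∧ IsTwoCycle z ∧ IsTwoBoundary (z - z')

end Cells

/-! ### The dual parameter and the self-dual point -/

section SelfDual

/-- The dual parameter `p* = (1-p)q / ((1-p)q + p)` of the plaquette random-cluster model.
[cite: DuncanSchweinhart2025, §4.3 (p*)] -/
noncomputable def dualParam (p q : ℝ) : ℝ := (1 - p) * q / ((1 - p) * q + p)

/-- The self-dual point `p_sd = √q / (1 + √q)`. [cite: DuncanSchweinhart2025, §4.3 (p_sd) and Thm. 8] -/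
noncomputable def selfDualPoint (q : ℝ) : ℝ := Real.sqrt q / (1 + Real.sqrt q)

/-- `p_sd ∈ (0, 1)` for `q > 0`. [cite: DuncanSchweinhart2025, §4.3] -/
theorem selfDualPoint_mem_Ioo {q : ℝ} (hq : 0 < q) : selfDualPoint q ∈ Set.Ioo (0 : ℝ) 1 := by
  have hs : 0 < Real.sqrt q := Real.sqrt_pos.mpr hq
  unfold selfDualPoint
  constructor
  · positivity
  · rw [div_lt_one (by positivity)]; linarith

/-- **`p_sd` is self-dual**: `(p_sd)* = p_sd` ("the self-dual point where `p = p*`").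
[cite: DuncanSchweinhart2025, §4.3] -/
theorem dualParam_selfDualPoint {q : ℝ} (hq : 0 < q) :
    dualParam (selfDualPoint q) q = selfDualPoint q := by
  have hs : 0 < Real.sqrt q := Real.sqrt_pos.mpr hq
  set s := Real.sqrt q with hs_def
  have hq' : q = s * s := (Real.mul_self_sqrt hq.le).symm
  have h1 : (1 : ℝ) + s ≠ 0 := by positivity
  have hs0 : s ≠ 0 := hs.ne'
  unfold dualParam selfDualPoint
  rw [← hs_def, hq']
  have e1 : 1 - s / (1 + s) = 1 / (1 + s) := by field_simp; ring
  rw [e1]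
  have e2 : 1 / (1 + s) * (s * s) + s / (1 + s) = s := by field_simp; ring
  rw [e2]
  field_simp

/-- For the Potts coupling `p = 1 - e^{-β}`, `p = p_sd(q)` iff `β = log(1 + √q)` (the conjectured
deconfinement point of `4`-dimensional `q`-state Potts lattice gauge theory, Conjecture 4).
[cite: DuncanSchweinhart2025, §1.1 Conj. 4 (β_sd(q) = log(1+√q))] -/
theorem esParam_log_one_add_sqrt {q : ℝ} (hq : 0 < q) :
    esParam (Real.log (1 + Real.sqrt q)) = selfDualPoint q := by
  have hs : 0 < Real.sqrt q := Real.sqrt_pos.mpr hq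
  have h1 : (0 : ℝ) < 1 + Real.sqrt q := by positivity
  unfold esParam selfDualPoint
  rw [Real.exp_neg, Real.exp_log h1]
  field_simp
  ring

end SelfDual

/-! ### Theorem 8 (`i = 2`, `d = 4`): named fact -/

section SharpTransition

/-- **Duncan–Schweinhart, Theorem 8, for the plaquette random-cluster model of `4`-dimensional
lattice gauge theory (`i = 2`, `d = 2i = 4`) — NAMED FACT.** For every coefficient field `F` with
`char F ≠ 2` and parameters `p ∈ [0,1]`, `q ≥ 1`: if `p < p_sd(q) = √q/(1+√q)` then the
probability, under the plaquette random-cluster model `μ_{𝕋⁴_N, p, q, 2, F}`, of the event `A`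
(a giant `2`-cycle: `φ_* : H₂(P; F) → H₂(𝕋⁴_N; F)` non-trivial) tends to `0` as `N → ∞`; if
`p > p_sd(q)` then the probability of `S` (`φ_*` surjective) tends to `1` (readings R9, R10). For
`q` an odd prime and `p = 1 - e^{-β}` this is the "giant sheets ruled by constant Polyakov loops"
transition of `q`-state Potts lattice gauge theory at `β_sd = log(1 + √q)` (§6.1, Cor. 37). The
printed proof uses torus duality (Thm. 18), the Graham–Grimmett sharp-threshold theorem and the
Duncan–Kahle–Schweinhart irreducible-representation lemma; it is not reproduced here.
[cite: DuncanSchweinhart2025, Thm. 8] -/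
def DuncanSchweinhart_sharpGiantCycleTransition : Prop :=
  ∀ (F : Type) [Field F] [DecidableEq F], ringChar F ≠ 2 →
    ∀ (p q : ℝ), p ∈ Set.Icc (0 : ℝ) 1 → 1 ≤ q →
      (p < selfDualPoint q →
        Tendsto (fun N : ℕ => eventProb (d := 4) (L := N + 1) F p q
          {ω | HasGiantCycle (R := F) ω}) atTop (𝓝 0)) ∧
      (selfDualPoint q < p →
        Tendsto (fun N : ℕ => eventProb (d := 4) (L := N + 1) F p q
          {ω | GiantCyclesSpan (R := F) ω}) atTop (𝓝 1))

end SharpTransition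

end PlaquetteRC

end Literature.MathematicalPhysics.QuantumFieldTheory
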